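/-
Copyright: statement-level skeleton of a published paper (lit-balaban cell, Phase-2 proof seat p27, gen 33). No proof claims
beyond what the kernel checks below.
-/
import Mathlib
import Literature.MathematicalPhysics.QuantumFieldTheory.BalabanImbrieJaffe1984to88.BIJ85Tau1ClosedCube

/-!
# `BalabanImbrieJaffe1984to88.BIJ85Eq7113LagrangeFibre` — T. Bałaban, J. Imbrie, A. Jaffe, *Renormalization of the Higgs model:
minimizers, propagators and the stability of mean field theory*, Commun. Math. Phys. **97** (1985) 299–329 [BalabanImbrieJaffe1985]:
Sect. 7.1 pp. 322–323, (7.1.12)–(7.1.16) — **THE LAGRANGE COMPUTATION BEHIND `σ_k = τ₁ + τ₂` FOR AN ARBITRARY FINITE SET OF SHIFTS**.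
p. 322: *"Starting from this expression, one can derive the following formulas for σ_k(p) by straightforward, algebraic
manipulation: We express σ_k as a sum of two terms σ_k = τ₁ + τ₂. (7.1.13)"*.  This file is that algebraic manipulation, done
ONCE for an abstract finite index set `ι` of shifts `l` (so that it serves r15's symmetric window `|m_i| ≤ M`, n = 2M + 1, AND
the complete residue system `k : Fin d → Fin n` of every block size n — file `BIJ85SigmaAllN`): the data at one unit momentum
`p′` are, shift by shift, the derivative vector `∂(p′+l) = e_l ∈ ℂ^d` ((7.1.4)), the bond-averaging weights `r_l = (u v_ν)(p′+l)`
of the constraint `Q_kA = 0` ([6I] (1.61)), the two-form `G_l = (Q^{e*}_kf)(p′+l)` ((7.1.11)), and the STRUCTURAL IDENTITY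
`r_{l,ν}·e_{l,ν} = u(p′+l)·∂^{(1)}_ν(p′)` ((7.1.7): `v_ν = ∂^{(1)}_ν/∂_ν`) — *"In the formula for τ₂, the averaging only occurs in
a_μ(p′)"* (p. 323) is exactly this factorisation.  With `E(α) = Σ_l ‖∂(p′+l) ∧ α_l − G_l‖²` (ordered pairs) and the constraint
`Σ_l r_l ⊙ α_l = 0`:
* Pythagoras against the shift-wise Hodge field `B₀(l) = Δ(l)⁻¹∂(l)^*G_l` (gen 31 `BIJ85Tau1ClosedCube.hodge_point`):
  `E(α) = T₁ + Σ_l ‖∂(l) ∧ (α_l − B₀(l))‖²`, `T₁ = Σ_l ‖(P_l ⊗ P_l)G_l‖²`, `P_l = [δ − ∂∂̄/Δ](p′+l)` — so `inf_α E = T₁` (the τ₁ part,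
  (7.1.14)/(7.1.17));
* under the constraint, with `c = Q_kB₀` (`c_ν = Σ_l r_{l,ν}B₀(l)_ν`), `φ_ν = Σ_l |r_{l,ν}|²/Δ(l)` ((7.1.10)), `D = diag(φ^{−1/2})`,
  `x = D∂^{(1)}`, `w = P_x(Dc)`, the multiplier `λ = Dw = Kc` with `K = DP_xD = Φ⁻¹ − Φ⁻¹∂^{(1)}∂^{(1)*}Φ⁻¹(Σ_ρ|∂^{(1)}_ρ|²/φ_ρ)⁻¹` — THE
  BRACKET OF (7.1.15) (`BIJ85Tau2Kernel715.wMat_eq`) — and `V = ‖w‖² = ⟨c, Kc⟩`:  LOWER BOUND `E(α) ≥ T₁ + 2V` (Cauchy–Schwarz with the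
  weights `Δ(l)^{∓1/2}`, using `∂^{(1)*}λ = 0` and the structural identity), and the EXPLICIT MINIMISER
  `α⋆_l = B₀(l) − Δ(l)⁻¹(r̄_l ⊙ λ) − [l = l₀](s₀/u(p′+l₀))·∂(l)` (a gauge term at one shift with `u ≠ 0` restores the `∂^{(1)}`-component
  `s₀ = ⟨x, Dc⟩/‖x‖²` of the constraint), which is constrained with `E(α⋆) = T₁ + 2V`.  Hence `min{E : Q_kA = 0} = T₁ + 2V`; in file
  `BIJ85SigmaAllN` `c = hVec a f` with print's `a_μ` of (7.1.16) and `2V = 2⟨f, τ₂f⟩` by `BIJ85Tau2Kernel715.tensorInner_tau2Kernel_eq_normSq`.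
No genericity is needed beyond `Δ(l) > 0` at every shift, `φ_ν > 0`, and `u(p′+l₀) ≠ 0` at ONE shift (all true at every `p′ ≠ 0`,
axes included); this replaces the continuity/density arguments of p10's generic derivation (`BIJ85Eq7113Derivation` Parts 1–5,
written for the symmetric window) by one algebraic argument valid for any shift set.

statement-level skeleton of published theorems with citation tags; proofs where landed; nothing here is a claim about
the Yang–Mills mass gap

PDF held: `paper:balaban1985-cmp97-bij-higgs-minimizers` (journal page = PDF page + 298); pp. 322–323 [PDF 24–25] re-read as images
(`run/shared/lean/pub/pub-balaban/t4/b2b-balaban-t4-lit2/renders/bij1985/1985-cmp97-bij-higgs-minimizers-p024-x2.png`, `…-p025-x2.png`).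

CITATION HEADER (lean-in-tree rule).  Part of the lit-balaban TYPED SKELETON (HOME `run/shared/lean/pub/lit-balaban/`), Phase-2 seat p27
(gen 33), unit `lit-balaban-p27`; rows **C1.Eq7.1.13-7.1.19** / **C1.Eq7.1.2-7.1.12** (fold owner r15, referee ref-5); r15's `C1-CLOSURE.md`
v1.5 §5 item 6 (lead g10 head word 2026-08-22T21:19:00Z, the Q2 flip trigger: *"a PARITY-FREE (or even-L) σ_k … with the identification
σ_k(p′) = τ₁(p′) + τ₂(p′) and (7.1.14)–(7.1.18)"*) — this file is its engine.  INPUTS (landed, by name): gen-2 `BIJ85CurlComplement719`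
(`IsTwoForm`, `projK`, `projK_apply`, `projK_conjTranspose`, `projK_mul_projK`), `BIJ85Tau2Kernel715` (`projK_mulVec_self`,
`normSq_projK_mulVec`, `scl`, `sqrtInv`, `norm_sqrtInv_sq`), gen-31 `BIJ85Tau1ClosedCube` (`hodge_point`, `kron_projK_mulVec_curl`).
WHAT IS KERNEL-CHECKED (zero `sorry`, standard axioms): §1 the data and the objects (`lap`, `energyL`, `ConstrL`, `tOne`, `hodgeB`, `cv`,
`phiL`, `wv`, `lamb`, `val`, `sZero`, `betaStar`, `alphaStar` — definitions with bodies); §2 **`pointwise_split`**, **`energyL_split`**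
(Pythagoras); §3 **`tOne_le_energyL`**, **`energyL_hodge`** (unconstrained minimum `= T₁`); §4 the multiplier identities `eps_dot_lamb`
(`∂^{(1)*}λ = 0`), `lamb_dot_cv` (`⟨λ,c⟩ = V`), `phiL_mul_lamb` (`φ_νλ_ν = c_ν − ∂^{(1)}_νs₀`); §5 **`constrL_alphaStar`**, **`energyL_alphaStar`**
(`= T₁ + 2V`); §6 **`lower_bound`** (`T₁ + 2V ≤ E(α)` for every constrained `α`).  HONEST SCOPE: pure finite-dimensional algebra at
one fibre; the dictionary to print's symbols (u, v, ∂, Q^e-weights, a_μ, φ_μ, τ₁, τ₂) is file `BIJ85SigmaAllN`.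
-/

namespace Literature.MathematicalPhysics.QuantumFieldTheory.BalabanImbrieJaffe1984to88.BIJ85Eq7113LagrangeFibre

open scoped BigOperators Matrix ComplexConjugate Kronecker
open BIJ85CurlComplement719 (IsTwoForm projK projK_apply projK_conjTranspose projK_mul_projK)
open BIJ85Tau2Kernel715 (projK_mulVec_self normSq_projK_mulVec scl sqrtInv norm_sqrtInv_sq)
open BIJ85Tau1ClosedCube (hodge_point kron_projK_mulVec_curl)

noncomputable section

variable {d : ℕ}

/-! ## §0 Kernel lemmas: Pythagoras under orthogonality, the bracket `P_e` as an explicit map -/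

/-- kernel: `Σ_i |a_i − b_i|² = Σ_i |a_i|² + Σ_i |b_i|²` when `Σ_i b̄_i a_i = 0`. [folklore] -/
private theorem sum_norm_sub_sq_of_orth {m : Type*} [Fintype m] (a b : m → ℂ) (h : ∑ i, conj (b i) * a i = 0) :
    ∑ i, ‖a i - b i‖ ^ 2 = (∑ i, ‖a i‖ ^ 2) + ∑ i, ‖b i‖ ^ 2 := by
  have hre : ∑ i, (a i * conj (b i)).re = 0 := by
    rw [← Complex.re_sum]
    have : ∑ i, a i * conj (b i) = ∑ i, conj (b i) * a i := Finset.sum_congr rfl fun i _ => mul_comm _ _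
    rw [this, h, Complex.zero_re]
  have hpt : ∀ i, ‖a i - b i‖ ^ 2 = ‖a i‖ ^ 2 + ‖b i‖ ^ 2 - 2 * (a i * conj (b i)).re := fun i => by
    rw [Complex.sq_norm, Complex.sq_norm, Complex.sq_norm, Complex.normSq_sub]
  simp only [hpt, Finset.sum_sub_distrib, Finset.sum_add_distrib, ← Finset.mul_sum, hre, mul_zero, sub_zero]

/-- kernel: for a self-adjoint idempotent matrix `M`, `x̄·(Mx) = Σ_i |(Mx)_i|²`. [folklore] -/
private theorem star_dot_mulVec_of_proj {m : Type*} [Fintype m] (M : Matrix m m ℂ) (hM : Mᴴ = M)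
    (hM2 : M * M = M) (x : m → ℂ) :
    star x ⬝ᵥ (M *ᵥ x) = ((∑ i, ‖(M *ᵥ x) i‖ ^ 2 : ℝ) : ℂ) := by
  have h : star x ⬝ᵥ (M *ᵥ x) = star (M *ᵥ x) ⬝ᵥ (M *ᵥ x) := by
    rw [Matrix.star_mulVec, hM, ← Matrix.dotProduct_mulVec, Matrix.mulVec_mulVec, hM2]
  rw [h]
  simp only [dotProduct, Pi.star_apply, Complex.star_def, Complex.conj_mul']
  push_cast
  rfl

/-- kernel: the bracket applied to a vector, `(P_x y)_ν = y_ν − x_ν⟨x, y⟩/Σ_ρ|x_ρ|²`. [cite: BalabanImbrieJaffe1985, (7.1.14) p.322] -/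
theorem projK_mulVec_apply (x y : Fin d → ℂ) (ν : Fin d) :
    (projK x *ᵥ y) ν = y ν - x ν * (star x ⬝ᵥ y) / (((∑ ρ, ‖x ρ‖ ^ 2 : ℝ)) : ℂ) := by
  simp only [Matrix.mulVec, dotProduct, projK_apply, sub_mul, Finset.sum_sub_distrib, ite_mul, one_mul, zero_mul,
    Finset.sum_ite_eq, Finset.mem_univ, if_true, Pi.star_apply, Complex.star_def]
  congr 1
  rw [Finset.mul_sum, Finset.sum_div]
  exact Finset.sum_congr rfl fun l _ => by ring

/-- kernel: the bracket fixes the vectors orthogonal to `x`. [cite: BalabanImbrieJaffe1985, (7.1.14) p.322] -/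
theorem projK_mulVec_of_orth {x y : Fin d → ℂ} (h : star x ⬝ᵥ y = 0) : projK x *ᵥ y = y := by
  funext ν
  rw [projK_mulVec_apply, h, mul_zero, zero_div, sub_zero]

/-- kernel: the range of the bracket is orthogonal to `x`: `⟨x, P_x y⟩ = 0` (also when `x = 0`). [cite: BalabanImbrieJaffe1985, (7.1.14) p.322] -/
theorem star_dot_projK_mulVec (x y : Fin d → ℂ) : star x ⬝ᵥ (projK x *ᵥ y) = 0 := by
  by_cases hx : (∑ ρ, ‖x ρ‖ ^ 2) = 0
  · have hx0 : x = 0 := by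
      funext ρ
      have h := (Finset.sum_eq_zero_iff_of_nonneg fun i _ => sq_nonneg ‖x i‖).mp hx ρ (Finset.mem_univ ρ)
      exact norm_eq_zero.mp (pow_eq_zero_iff two_ne_zero |>.mp h)
    rw [hx0, star_zero, zero_dotProduct]
  · have h : star x ᵥ* projK x = star (projK x *ᵥ x) := by rw [Matrix.star_mulVec, projK_conjTranspose]
    rw [Matrix.dotProduct_mulVec, h, projK_mulVec_self hx, star_zero, zero_dotProduct]

/-- kernel: the bracket on two-forms is self-adjoint. [cite: BalabanImbrieJaffe1985, (7.1.14) p.322] -/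
private theorem kron_conjTranspose (E : Fin d → ℂ) : (projK E ⊗ₖ projK E)ᴴ = projK E ⊗ₖ projK E := by
  rw [Matrix.conjTranspose_kronecker, projK_conjTranspose]

/-- kernel: `(P⊗P)G ⟂ ∂ ∧ β` — the projected two-form is orthogonal to every curl at the same shift. [cite: BalabanImbrieJaffe1985, (7.1.18) p.323] -/
private theorem orth_proj_curl (E β : Fin d → ℂ) (G : Fin d → Fin d → ℂ) :
    ∑ i : Fin d × Fin d, conj (((projK E ⊗ₖ projK E) *ᵥ fun i : Fin d × Fin d => G i.1 i.2) i) *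
      (E i.1 * β i.2 - E i.2 * β i.1) = 0 := by
  have h : star ((projK E ⊗ₖ projK E) *ᵥ fun i : Fin d × Fin d => G i.1 i.2) ⬝ᵥ
      (fun i : Fin d × Fin d => E i.1 * β i.2 - E i.2 * β i.1) = 0 := by
    rw [Matrix.star_mulVec, kron_conjTranspose, ← Matrix.dotProduct_mulVec, kron_projK_mulVec_curl, dotProduct_zero]
  simpa only [dotProduct, Pi.star_apply, Complex.star_def] using h

/-! ## §1 The data of one fibre over an arbitrary finite shift set `ι`, and the objects of the computation -/

section Defs

variable {ι : Type*} [Fintype ι]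

/-- `Δ(p′+l) = Σ_ρ |∂_ρ(p′+l)|²` at the shift `l` ((7.1.6)). [cite: BalabanImbrieJaffe1985, (7.1.6) p.322] -/
def lap (e : ι → Fin d → ℂ) (k : ι) : ℝ := ∑ ρ, ‖e k ρ‖ ^ 2

/-- The fibre energy `Σ_l ‖∂(p′+l) ∧ α_l − G_l‖²` over ordered pairs `(μ, ν)` — the exponent of (4.2.1) restricted to one unit
momentum ((7.1.12)). [cite: BalabanImbrieJaffe1985, (7.1.12) p.322] -/
def energyL (e : ι → Fin d → ℂ) (G : ι → Fin d → Fin d → ℂ) (α : ι → Fin d → ℂ) : ℝ :=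
  ∑ k, ∑ μ, ∑ ν, ‖e k μ * α k ν - e k ν * α k μ - G k μ ν‖ ^ 2

/-- The fibre constraint `(Q_kA)_μ(p′) = Σ_l r_μ(p′+l) α_l(μ) = 0` ([6I] (1.61) inside δ(Q_kA) of (4.2.1)). [cite: BalabanImbrieJaffe1985, (4.2.1) p.310] -/
def ConstrL (r : ι → Fin d → ℂ) (α : ι → Fin d → ℂ) : Prop := ∀ μ, ∑ k, r k μ * α k μ = 0

/-- `T₁ = Σ_l ‖(P_l ⊗ P_l) G_l‖²`, `P_l = [δ − ∂∂̄/Δ](p′+l)` — the τ₁-part ((7.1.14): *"τ₁ = Q^e_k(I − P_∂)Q^{e*}_k (7.1.17)"*).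
[cite: BalabanImbrieJaffe1985, (7.1.14) p.322] -/
def tOne (e : ι → Fin d → ℂ) (G : ι → Fin d → Fin d → ℂ) : ℝ :=
  ∑ k, ∑ i : Fin d × Fin d, ‖((projK (e k) ⊗ₖ projK (e k)) *ᵥ fun i : Fin d × Fin d => G k i.1 i.2) i‖ ^ 2

/-- The Hodge coefficient `B₀ = Δ⁻¹∂^*G` of one two-form against one vector (the curl part of the pointwise Hodge split,
gen-31 `hodge_point`). [cite: BalabanImbrieJaffe1985, (7.1.17) p.323] -/
def hodgeB (E : Fin d → ℂ) (G : Fin d → Fin d → ℂ) (ν : Fin d) : ℂ :=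
  (∑ l, conj (E l) * G l ν) / (((∑ ρ, ‖E ρ‖ ^ 2 : ℝ)) : ℂ)

/-- `c_ν = (Q_kB₀)_ν = Σ_l r_ν(p′+l) B₀(l)_ν`: the constraint defect of the shift-wise Hodge field. [cite: BalabanImbrieJaffe1985, (7.1.15) p.323] -/
def cv (e r : ι → Fin d → ℂ) (G : ι → Fin d → Fin d → ℂ) (ν : Fin d) : ℂ := ∑ k, r k ν * hodgeB (e k) (G k) ν

/-- `φ_ν(p′) = Σ_l |r_ν(p′+l)|²/Δ(p′+l)` — (7.1.10) *"φ_μ(p′) = Σ_l |u(p′+l)v_μ(p′+l)|²Δ(p′+l)^{−1}"* for abstract weights.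
[cite: BalabanImbrieJaffe1985, (7.1.10) p.322] -/
def phiL (e r : ι → Fin d → ℂ) (ν : Fin d) : ℝ := ∑ k, ‖r k ν‖ ^ 2 / lap e k

/-- `w = P_x(Dc)`, `x = D∂^{(1)}`, `D = diag(φ^{−1/2})` — the projected rescaled defect (the bracket of (7.1.15) is `DP_xD`,
`BIJ85Tau2Kernel715.wMat_eq`). [cite: BalabanImbrieJaffe1985, (7.1.15) p.323] -/
def wv (e r : ι → Fin d → ℂ) (G : ι → Fin d → Fin d → ℂ) (ε : Fin d → ℂ) : Fin d → ℂ :=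
  projK (scl (phiL e r) ε) *ᵥ scl (phiL e r) (cv e r G)

/-- The Lagrange multiplier `λ = Dw = Kc`, `K = Φ⁻¹ − Φ⁻¹∂^{(1)}∂^{(1)*}Φ⁻¹N⁻¹` the (7.1.15) bracket. [cite: BalabanImbrieJaffe1985, (7.1.15) p.323] -/
def lamb (e r : ι → Fin d → ℂ) (G : ι → Fin d → Fin d → ℂ) (ε : Fin d → ℂ) : Fin d → ℂ :=
  scl (phiL e r) (wv e r G ε)

/-- `V = ‖w‖² = ⟨c, Kc⟩` — half the τ₂-part of the constrained minimum. [cite: BalabanImbrieJaffe1985, (7.1.15) p.323] -/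
def val (e r : ι → Fin d → ℂ) (G : ι → Fin d → Fin d → ℂ) (ε : Fin d → ℂ) : ℝ := ∑ ν, ‖wv e r G ε ν‖ ^ 2

/-- `s₀ = ⟨x, Dc⟩/‖x‖²`: the `∂^{(1)}`-component of the rescaled defect, to be absorbed by a gauge term. [cite: BalabanImbrieJaffe1985, (7.1.15) p.323] -/
def sZero (e r : ι → Fin d → ℂ) (G : ι → Fin d → Fin d → ℂ) (ε : Fin d → ℂ) : ℂ :=
  (star (scl (phiL e r) ε) ⬝ᵥ scl (phiL e r) (cv e r G)) / (((∑ ρ, ‖scl (phiL e r) ε ρ‖ ^ 2 : ℝ)) : ℂ)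

variable [DecidableEq ι]

/-- The correction `β⋆_l = −Δ(l)⁻¹(r̄_l ⊙ λ) − [l = l₀](s₀/u(p′+l₀))∂(l)`. [cite: BalabanImbrieJaffe1985, (7.1.15) p.323] -/
def betaStar (e r : ι → Fin d → ℂ) (G : ι → Fin d → Fin d → ℂ) (ε : Fin d → ℂ) (u : ι → ℂ) (k₀ : ι) (k : ι) (ν : Fin d) : ℂ :=
  -((((lap e k : ℝ) : ℂ))⁻¹ * (conj (r k ν) * lamb e r G ε ν)) +
    (if k = k₀ then -(sZero e r G ε) / u k₀ else 0) * e k ν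

/-- **The constrained minimiser** `α⋆_l = B₀(l) + β⋆_l` of `‖∂A − Q^{e*}_kf‖²` over `{Q_kA = 0}` at one fibre.
[cite: BalabanImbrieJaffe1985, (7.1.12) p.322] -/
def alphaStar (e r : ι → Fin d → ℂ) (G : ι → Fin d → Fin d → ℂ) (ε : Fin d → ℂ) (u : ι → ℂ) (k₀ : ι) (k : ι) (ν : Fin d) : ℂ :=
  hodgeB (e k) (G k) ν + betaStar e r G ε u k₀ k ν

end Defs

/-! ## §2 Pythagoras against the shift-wise Hodge field -/

section Split

variable {ι : Type*} [Fintype ι]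

/-- **At one shift**: `Σ_{μν}|e_μa_ν − e_νa_μ − G_{μν}|² = ‖(P⊗P)G‖² + Σ_{μν}|e_μ(a−B₀)_ν − e_ν(a−B₀)_μ|²` for EVERY vector `e` (zero
included) and every two-form `G` — gen-31's Hodge split `G = e ∧ B₀ + (P⊗P)G` plus `(P⊗P)G ⟂ curls`. [cite: BalabanImbrieJaffe1985, (7.1.17) p.323] -/
theorem pointwise_split (E : Fin d → ℂ) {G : Fin d → Fin d → ℂ} (hG : IsTwoForm G) (a : Fin d → ℂ) :
    ∑ μ, ∑ ν, ‖E μ * a ν - E ν * a μ - G μ ν‖ ^ 2 =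
      (∑ i : Fin d × Fin d, ‖((projK E ⊗ₖ projK E) *ᵥ fun i : Fin d × Fin d => G i.1 i.2) i‖ ^ 2) +
        ∑ μ, ∑ ν, ‖E μ * (a ν - hodgeB E G ν) - E ν * (a μ - hodgeB E G μ)‖ ^ 2 := by
  set R : Fin d × Fin d → ℂ := (projK E ⊗ₖ projK E) *ᵥ fun i : Fin d × Fin d => G i.1 i.2 with hR
  have hRi : ∀ μ ν, R (μ, ν) = ∑ l, ∑ κ, projK E μ l * projK E ν κ * G l κ := fun μ ν => by
    rw [hR, Matrix.mulVec, dotProduct, Fintype.sum_prod_type]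
    simp only [Matrix.kroneckerMap_apply]
  have hpt : ∀ μ ν, E μ * a ν - E ν * a μ - G μ ν =
      (E μ * (a ν - hodgeB E G ν) - E ν * (a μ - hodgeB E G μ)) - R (μ, ν) := fun μ ν => by
    have h := hodge_point E hG μ ν
    rw [hRi]
    unfold hodgeB
    rw [h]
    ring
  have hsum : ∑ μ, ∑ ν, ‖E μ * a ν - E ν * a μ - G μ ν‖ ^ 2 =
      ∑ i : Fin d × Fin d, ‖(E i.1 * (a i.2 - hodgeB E G i.2) - E i.2 * (a i.1 - hodgeB E G i.1)) - R i‖ ^ 2 := by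
    rw [Fintype.sum_prod_type]
    exact Finset.sum_congr rfl fun μ _ => Finset.sum_congr rfl fun ν _ => by rw [hpt]
  have horth : ∑ i : Fin d × Fin d, conj (R i) *
      (E i.1 * (a i.2 - hodgeB E G i.2) - E i.2 * (a i.1 - hodgeB E G i.1)) = 0 :=
    orth_proj_curl E (fun j => a j - hodgeB E G j) G
  rw [hsum, sum_norm_sub_sq_of_orth _ _ horth, add_comm]
  congr 1
  rw [Fintype.sum_prod_type]

/-- **`E(α) = T₁ + Σ_l ‖∂(l) ∧ (α_l − B₀(l))‖²`** for every family `α` (two-forms `G_l`). [cite: BalabanImbrieJaffe1985, (7.1.13) p.322] -/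
theorem energyL_split (e : ι → Fin d → ℂ) {G : ι → Fin d → Fin d → ℂ} (hG : ∀ k, IsTwoForm (G k)) (α : ι → Fin d → ℂ) :
    energyL e G α = tOne e G +
      ∑ k, ∑ μ, ∑ ν, ‖e k μ * (α k ν - hodgeB (e k) (G k) ν) - e k ν * (α k μ - hodgeB (e k) (G k) μ)‖ ^ 2 := by
  unfold energyL tOne
  rw [← Finset.sum_add_distrib]
  exact Finset.sum_congr rfl fun k _ => pointwise_split (e k) (hG k) (α k)

/-! ## §3 The unconstrained minimum is `T₁` (the τ₁ part) -/

/-- `T₁ ≤ E(α)` for every `α`. [cite: BalabanImbrieJaffe1985, (7.1.14) p.322] -/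
theorem tOne_le_energyL (e : ι → Fin d → ℂ) {G : ι → Fin d → Fin d → ℂ} (hG : ∀ k, IsTwoForm (G k)) (α : ι → Fin d → ℂ) :
    tOne e G ≤ energyL e G α := by
  rw [energyL_split e hG α]
  have : 0 ≤ ∑ k, ∑ μ, ∑ ν, ‖e k μ * (α k ν - hodgeB (e k) (G k) ν) - e k ν * (α k μ - hodgeB (e k) (G k) μ)‖ ^ 2 := by
    positivity
  linarith

/-- `E(B₀) = T₁`: the shift-wise Hodge field attains the unconstrained minimum. [cite: BalabanImbrieJaffe1985, (7.1.14) p.322] -/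
theorem energyL_hodge (e : ι → Fin d → ℂ) {G : ι → Fin d → Fin d → ℂ} (hG : ∀ k, IsTwoForm (G k)) :
    energyL e G (fun k => hodgeB (e k) (G k)) = tOne e G := by
  rw [energyL_split e hG]
  simp

end Split

/-! ## §4 The multiplier `λ = Kc`: `∂^{(1)*}λ = 0`, `⟨λ, c⟩ = V`, `φ_νλ_ν = c_ν − ∂^{(1)}_ν s₀` -/

section Multiplier

variable {ι : Type*} [Fintype ι] (e r : ι → Fin d → ℂ) (G : ι → Fin d → Fin d → ℂ) (ε : Fin d → ℂ)

/-- kernel: `φ^{−1/2}` is real. [folklore] -/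
private theorem conj_sqrtInv (φ : Fin d → ℝ) (ν : Fin d) : conj (sqrtInv φ ν) = sqrtInv φ ν := by
  rw [sqrtInv, Complex.conj_ofReal]

/-- kernel: `φ_ν · (φ_ν^{−1/2})² = 1` for `φ_ν > 0`. [folklore] -/
private theorem phi_mul_sqrtInv_sq {φ : Fin d → ℝ} {ν : Fin d} (h : 0 < φ ν) :
    ((φ ν : ℝ) : ℂ) * (sqrtInv φ ν * sqrtInv φ ν) = 1 := by
  rw [sqrtInv, ← Complex.ofReal_mul, ← mul_inv, Real.mul_self_sqrt h.le, ← Complex.ofReal_mul, mul_inv_cancel₀ h.ne',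
    Complex.ofReal_one]

/-- **`∂^{(1)*}λ = 0`**: the multiplier is orthogonal to `∂^{(1)}(p′)` (`λ = Dw`, `w = P_x(Dc) ⟂ x = D∂^{(1)}`).
[cite: BalabanImbrieJaffe1985, (7.1.15) p.323] -/
theorem eps_dot_lamb : ∑ ν, conj (ε ν) * lamb e r G ε ν = 0 := by
  have h := star_dot_projK_mulVec (scl (phiL e r) ε) (scl (phiL e r) (cv e r G))
  rw [dotProduct] at h
  rw [← h]
  refine Finset.sum_congr rfl fun ν _ => ?_
  rw [lamb, wv, scl, Pi.star_apply, Complex.star_def, scl, map_mul, conj_sqrtInv]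
  ring

/-- **`⟨λ, c⟩ = V`** (a real number): `Σ_ν λ̄_νc_ν = ⟨w, Dc⟩ = ⟨P_x(Dc), Dc⟩ = ‖P_x(Dc)‖²`. [cite: BalabanImbrieJaffe1985, (7.1.15) p.323] -/
theorem lamb_dot_cv : ∑ ν, conj (lamb e r G ε ν) * cv e r G ν = ((val e r G ε : ℝ) : ℂ) := by
  set x := scl (phiL e r) ε
  set y := scl (phiL e r) (cv e r G) with hy
  have h1 : ∑ ν, conj (lamb e r G ε ν) * cv e r G ν = star (projK x *ᵥ y) ⬝ᵥ y := by
    rw [dotProduct]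
    refine Finset.sum_congr rfl fun ν _ => ?_
    rw [Pi.star_apply, Complex.star_def, lamb, wv, scl, map_mul, conj_sqrtInv, hy, scl]
    ring
  rw [h1, Matrix.star_mulVec, projK_conjTranspose, ← Matrix.dotProduct_mulVec,
    star_dot_mulVec_of_proj _ (projK_conjTranspose _) (projK_mul_projK _), val, wv]

/-- **`φ_ν λ_ν = c_ν − ∂^{(1)}_ν s₀`** (`φ > 0`): undoing the rescaling, `D⁻¹w = c − ∂^{(1)}·⟨x, Dc⟩/‖x‖²`.
[cite: BalabanImbrieJaffe1985, (7.1.15) p.323] -/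
theorem phiL_mul_lamb (hphi : ∀ ν, 0 < phiL e r ν) (ν : Fin d) :
    ((phiL e r ν : ℝ) : ℂ) * lamb e r G ε ν = cv e r G ν - ε ν * sZero e r G ε := by
  have h1 := phi_mul_sqrtInv_sq (hphi ν)
  rw [lamb, wv, scl, projK_mulVec_apply, sZero]
  simp only [scl]
  set S : ℂ := star (fun ν => sqrtInv (phiL e r) ν * ε ν) ⬝ᵥ (fun ν => sqrtInv (phiL e r) ν * cv e r G ν)
  set N : ℂ := (((∑ ρ, ‖sqrtInv (phiL e r) ρ * ε ρ‖ ^ 2 : ℝ)) : ℂ)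
  calc ((phiL e r ν : ℝ) : ℂ) * (sqrtInv (phiL e r) ν *
        (sqrtInv (phiL e r) ν * cv e r G ν - sqrtInv (phiL e r) ν * ε ν * S / N))
      = ((phiL e r ν : ℝ) : ℂ) * (sqrtInv (phiL e r) ν * sqrtInv (phiL e r) ν) * (cv e r G ν - ε ν * (S / N)) := by ring
    _ = cv e r G ν - ε ν * (S / N) := by rw [h1, one_mul]

end Multiplier

/-! ## §5 The explicit minimiser is constrained and has energy `T₁ + 2V` -/

section Minimiser

variable {ι : Type*} [Fintype ι] (e r : ι → Fin d → ℂ) (G : ι → Fin d → Fin d → ℂ) (ε : Fin d → ℂ) (u : ι → ℂ)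

/-- kernel: `r · conj r = |r|²`. [folklore] -/
private theorem mul_conj_eq_norm_sq (z : ℂ) : z * conj z = ((‖z‖ ^ 2 : ℝ) : ℂ) := by
  rw [Complex.mul_conj']
  push_cast
  rfl

/-- `Σ_l r_ν(l)·(−Δ(l)⁻¹ r̄_ν(l) λ_ν) = −φ_ν λ_ν`. [cite: BalabanImbrieJaffe1985, (7.1.10) p.322] -/
theorem sum_r_mul_main (ν : Fin d) :
    ∑ k, r k ν * -((((lap e k : ℝ) : ℂ))⁻¹ * (conj (r k ν) * lamb e r G ε ν)) =
      -(((phiL e r ν : ℝ) : ℂ) * lamb e r G ε ν) := by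
  have h : ∀ k, r k ν * -((((lap e k : ℝ) : ℂ))⁻¹ * (conj (r k ν) * lamb e r G ε ν)) =
      -((((‖r k ν‖ ^ 2 / lap e k : ℝ)) : ℂ) * lamb e r G ε ν) := fun k => by
    rw [Complex.ofReal_div, div_eq_mul_inv, ← mul_conj_eq_norm_sq]
    ring
  simp only [h, Finset.sum_neg_distrib, ← Finset.sum_mul, phiL, Complex.ofReal_sum]

/-- `Σ_l r_ν(l)·(gauge term)_ν = −s₀ ∂^{(1)}_ν`, by the structural identity `r ⊙ ∂ = u·∂^{(1)}` and `u(l₀) ≠ 0`.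
[cite: BalabanImbrieJaffe1985, (7.1.7) p.322] -/
theorem sum_r_mul_gauge [DecidableEq ι] (k₀ : ι) (hfac : ∀ k μ, r k μ * e k μ = u k * ε μ) (hu : u k₀ ≠ 0) (ν : Fin d) :
    ∑ k, r k ν * ((if k = k₀ then -(sZero e r G ε) / u k₀ else 0) * e k ν) = -(sZero e r G ε) * ε ν := by
  rw [Finset.sum_eq_single k₀]
  · rw [if_pos rfl]
    calc r k₀ ν * (-(sZero e r G ε) / u k₀ * e k₀ ν) = -(sZero e r G ε) / u k₀ * (r k₀ ν * e k₀ ν) := by ring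
      _ = (-(sZero e r G ε) / u k₀ * u k₀) * ε ν := by rw [hfac]; ring
      _ = -(sZero e r G ε) * ε ν := by rw [div_mul_cancel₀ _ hu]
  · intro k _ hk
    rw [if_neg hk, zero_mul, mul_zero]
  · intro h
    exact absurd (Finset.mem_univ _) h

/-- **`Q_kα⋆ = 0`**: the explicit field `α⋆ = B₀ − Δ⁻¹(r̄ ⊙ λ) − [l = l₀](s₀/u)∂` is constrained (`φ > 0`, `u(p′+l₀) ≠ 0`,
`r ⊙ ∂ = u·∂^{(1)}`). [cite: BalabanImbrieJaffe1985, (7.1.12) p.322] -/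
theorem constrL_alphaStar [DecidableEq ι] (k₀ : ι) (hfac : ∀ k μ, r k μ * e k μ = u k * ε μ) (hu : u k₀ ≠ 0)
    (hphi : ∀ ν, 0 < phiL e r ν) : ConstrL r (alphaStar e r G ε u k₀) := by
  intro ν
  have hc : ∑ k, r k ν * hodgeB (e k) (G k) ν = cv e r G ν := rfl
  simp only [alphaStar, betaStar, mul_add, Finset.sum_add_distrib, hc, sum_r_mul_main, sum_r_mul_gauge e r G ε u k₀ hfac hu,
    phiL_mul_lamb e r G ε hphi]
  ring

/-- kernel: at each shift the correction `−Δ⁻¹(r̄ ⊙ λ)` is orthogonal to `∂(l)` (structural identity + `∂^{(1)*}λ = 0`).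
[cite: BalabanImbrieJaffe1985, (7.1.15) p.323] -/
theorem e_dot_main (hfac : ∀ k μ, r k μ * e k μ = u k * ε μ) (k : ι) :
    star (e k) ⬝ᵥ (fun ν => -((((lap e k : ℝ) : ℂ))⁻¹ * (conj (r k ν) * lamb e r G ε ν))) = 0 := by
  have h0 := eps_dot_lamb e r G ε
  have h : ∀ ν, conj (e k ν) * -((((lap e k : ℝ) : ℂ))⁻¹ * (conj (r k ν) * lamb e r G ε ν)) =
      -((((lap e k : ℝ) : ℂ))⁻¹ * conj (u k)) * (conj (ε ν) * lamb e r G ε ν) := fun ν => by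
    have h1 : conj (e k ν) * conj (r k ν) = conj (u k) * conj (ε ν) := by
      rw [← map_mul, ← map_mul, mul_comm (e k ν), hfac]
    calc conj (e k ν) * -((((lap e k : ℝ) : ℂ))⁻¹ * (conj (r k ν) * lamb e r G ε ν))
        = -((((lap e k : ℝ) : ℂ))⁻¹ * ((conj (e k ν) * conj (r k ν)) * lamb e r G ε ν)) := by ring
      _ = _ := by rw [h1]; ring
  simp only [dotProduct, Pi.star_apply, Complex.star_def, h, ← Finset.mul_sum, h0, mul_zero]

/-- **`E(α⋆) = T₁ + 2V`**. [cite: BalabanImbrieJaffe1985, (7.1.13) p.322] -/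
theorem energyL_alphaStar [DecidableEq ι] (k₀ : ι) {G : ι → Fin d → Fin d → ℂ} (hG : ∀ k, IsTwoForm (G k))
    (hlap : ∀ k, 0 < lap e k) (hfac : ∀ k μ, r k μ * e k μ = u k * ε μ) (hphi : ∀ ν, 0 < phiL e r ν) :
    energyL e G (alphaStar e r G ε u k₀) = tOne e G + 2 * val e r G ε := by
  rw [energyL_split e hG]
  congr 1
  -- the main correction at shift k
  set m : ι → Fin d → ℂ := fun k ν => -((((lap e k : ℝ) : ℂ))⁻¹ * (conj (r k ν) * lamb e r G ε ν)) with hm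
  have hβ : ∀ k μ ν, e k μ * (alphaStar e r G ε u k₀ k ν - hodgeB (e k) (G k) ν) -
      e k ν * (alphaStar e r G ε u k₀ k μ - hodgeB (e k) (G k) μ) = e k μ * m k ν - e k ν * m k μ := fun k μ ν => by
    simp only [alphaStar, betaStar, hm]
    ring
  simp only [hβ]
  -- per shift: Σ|e∧m|² = 2Δ‖P m‖² = 2Δ‖m‖² (m ⟂ e)
  have hk : ∀ k, ∑ μ, ∑ ν, ‖e k μ * m k ν - e k ν * m k μ‖ ^ 2 = 2 * ∑ ν, ‖r k ν‖ ^ 2 / lap e k * ‖lamb e r G ε ν‖ ^ 2 := by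
    intro k
    have hl : lap e k ≠ 0 := (hlap k).ne'
    have hP : projK (e k) *ᵥ m k = m k := projK_mulVec_of_orth (e_dot_main e r G ε u hfac k)
    have h1 := normSq_projK_mulVec (e := e k) hl (m k)
    rw [hP] at h1
    set S := ∑ μ, ∑ ν, ‖e k μ * m k ν - e k ν * m k μ‖ ^ 2 with hS
    have h2 : S = 2 * (lap e k * ∑ i, ‖m k i‖ ^ 2) := by
      rw [h1]
      change S = 2 * (lap e k * (1 / 2 * (lap e k)⁻¹ * S))
      calc S = 2 * (1 / 2) * (lap e k * (lap e k)⁻¹) * S := by rw [mul_inv_cancel₀ hl]; ring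
        _ = 2 * (lap e k * (1 / 2 * (lap e k)⁻¹ * S)) := by ring
    rw [h2, Finset.mul_sum]
    congr 1
    refine Finset.sum_congr rfl fun ν _ => ?_
    have hmn : ‖m k ν‖ = (lap e k)⁻¹ * (‖r k ν‖ * ‖lamb e r G ε ν‖) := by
      rw [hm]
      simp only [norm_neg, norm_mul, norm_inv, Complex.norm_real, Real.norm_eq_abs, abs_of_pos (hlap k),
        Complex.norm_conj]
    rw [hmn, div_eq_mul_inv]
    calc lap e k * ((lap e k)⁻¹ * (‖r k ν‖ * ‖lamb e r G ε ν‖)) ^ 2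
        = (lap e k * (lap e k)⁻¹) * (‖r k ν‖ ^ 2 * (lap e k)⁻¹ * ‖lamb e r G ε ν‖ ^ 2) := by ring
      _ = ‖r k ν‖ ^ 2 * (lap e k)⁻¹ * ‖lamb e r G ε ν‖ ^ 2 := by rw [mul_inv_cancel₀ hl, one_mul]
  simp only [hk, ← Finset.mul_sum]
  congr 1
  rw [Finset.sum_comm]
  simp only [← Finset.sum_mul]
  rw [val]
  refine Finset.sum_congr rfl fun ν _ => ?_
  have hφ : phiL e r ν ≠ 0 := (hphi ν).ne'
  rw [show (∑ k, ‖r k ν‖ ^ 2 / lap e k) = phiL e r ν from rfl, lamb, scl, norm_mul, mul_pow, norm_sqrtInv_sq hphi,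
    ← mul_assoc, mul_inv_cancel₀ hφ, one_mul]

end Minimiser

/-! ## §6 The lower bound `T₁ + 2V ≤ E(α)` on the constraint set -/

section Lower

variable {ι : Type*} [Fintype ι] (e r : ι → Fin d → ℂ) (G : ι → Fin d → Fin d → ℂ) (ε : Fin d → ℂ) (u : ι → ℂ)

/-- kernel: the real Cauchy–Schwarz step `|Σ_i X̄_iY_i|² ≤ (Σ|X_i|²)(Σ|Y_i|²)`. [folklore] -/
private theorem norm_sum_conj_mul_sq_le {m : Type*} [Fintype m] (X Y : m → ℂ) :
    ‖∑ i, conj (X i) * Y i‖ ^ 2 ≤ (∑ i, ‖X i‖ ^ 2) * ∑ i, ‖Y i‖ ^ 2 := by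
  have h1 : ‖∑ i, conj (X i) * Y i‖ ≤ ∑ i, ‖X i‖ * ‖Y i‖ := by
    refine (norm_sum_le _ _).trans (Finset.sum_le_sum fun i _ => ?_)
    rw [norm_mul, Complex.norm_conj]
  have h2 : (∑ i, ‖X i‖ * ‖Y i‖) ^ 2 ≤ (∑ i, ‖X i‖ ^ 2) * ∑ i, ‖Y i‖ ^ 2 :=
    Finset.sum_mul_sq_le_sq_mul_sq Finset.univ (fun i => ‖X i‖) (fun i => ‖Y i‖)
  exact (pow_le_pow_left₀ (norm_nonneg _) h1 2).trans h2

/-- **`T₁ + 2V ≤ E(α)` for every constrained `α`** (`Δ(l) > 0` at every shift, `φ > 0`, `r ⊙ ∂ = u·∂^{(1)}`): with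
`β = α − B₀`, the constraint gives `Σ_l r_l ⊙ β_l = −c`, so `V = ⟨λ, c⟩ = −Σ_l⟨r̄_l ⊙ λ, β_l⟩ = −Σ_l⟨r̄_l ⊙ λ, P_lβ_l⟩` (the multiplier
sees only the transversal part, `r ⊙ ∂ = u∂^{(1)} ⟂ λ`), and Cauchy–Schwarz with the weights `Δ(l)^{∓1/2}` gives
`V² ≤ (Σ_lΔ(l)⁻¹‖r̄_l ⊙ λ‖²)(Σ_lΔ(l)‖P_lβ_l‖²) = V · ½Σ_l‖∂(l) ∧ β_l‖²`. [cite: BalabanImbrieJaffe1985, (7.1.13) p.322] -/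
theorem lower_bound {G : ι → Fin d → Fin d → ℂ} (hG : ∀ k, IsTwoForm (G k)) (hlap : ∀ k, 0 < lap e k)
    (hfac : ∀ k μ, r k μ * e k μ = u k * ε μ) (hphi : ∀ ν, 0 < phiL e r ν) {α : ι → Fin d → ℂ} (hα : ConstrL r α) :
    tOne e G + 2 * val e r G ε ≤ energyL e G α := by
  rw [energyL_split e hG α]
  set β : ι → Fin d → ℂ := fun k ν => α k ν - hodgeB (e k) (G k) ν with hβ
  -- R = the β-energy
  set R : ℝ := ∑ k, ∑ μ, ∑ ν, ‖e k μ * β k ν - e k ν * β k μ‖ ^ 2 with hR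
  change tOne e G + 2 * val e r G ε ≤ tOne e G + R
  -- Step 1: the constraint in terms of β
  have hcon : ∀ ν, ∑ k, r k ν * β k ν = -cv e r G ν := fun ν => by
    have h := hα ν
    simp only [hβ, mul_sub, Finset.sum_sub_distrib]
    rw [h, zero_sub, cv]
  -- Step 2: S = Σ_k ⟨r̄_k ⊙ λ, β_k⟩ = -V
  have hS : ∑ k, ∑ ν, conj (conj (r k ν) * lamb e r G ε ν) * β k ν = -((val e r G ε : ℝ) : ℂ) := by
    rw [Finset.sum_comm]
    have h : ∀ ν, ∑ k, conj (conj (r k ν) * lamb e r G ε ν) * β k ν = -(conj (lamb e r G ε ν) * cv e r G ν) := by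
      intro ν
      rw [← mul_neg, ← hcon ν, Finset.mul_sum]
      exact Finset.sum_congr rfl fun k _ => by rw [map_mul, Complex.conj_conj]; ring
    rw [Finset.sum_congr rfl fun ν _ => h ν, Finset.sum_neg_distrib, lamb_dot_cv]
  -- Step 3: the multiplier sees only P_k β_k
  have hproj : ∀ k, ∑ ν, conj (conj (r k ν) * lamb e r G ε ν) * β k ν =
      ∑ ν, conj (conj (r k ν) * lamb e r G ε ν) * (projK (e k) *ᵥ β k) ν := by
    intro k
    have hye : ∑ ν, conj (conj (r k ν) * lamb e r G ε ν) * e k ν = 0 := by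
      have h0 := eps_dot_lamb e r G ε
      have h1 : ∀ ν, conj (conj (r k ν) * lamb e r G ε ν) * e k ν = u k * conj (conj (ε ν) * lamb e r G ε ν) := by
        intro ν
        rw [map_mul, Complex.conj_conj, map_mul, Complex.conj_conj]
        calc r k ν * conj (lamb e r G ε ν) * e k ν = (r k ν * e k ν) * conj (lamb e r G ε ν) := by ring
          _ = u k * ε ν * conj (lamb e r G ε ν) := by rw [hfac]
          _ = u k * (ε ν * conj (lamb e r G ε ν)) := by ring
      simp only [h1, ← Finset.mul_sum]
      rw [← map_sum, h0, map_zero, mul_zero]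
    have h2 : ∀ ν, (projK (e k) *ᵥ β k) ν = β k ν - e k ν * (star (e k) ⬝ᵥ β k) / (((∑ ρ, ‖e k ρ‖ ^ 2 : ℝ)) : ℂ) :=
      fun ν => projK_mulVec_apply _ _ ν
    simp only [h2, mul_sub, Finset.sum_sub_distrib]
    have h3 : ∑ ν, conj (conj (r k ν) * lamb e r G ε ν) * (e k ν * (star (e k) ⬝ᵥ β k) / (((∑ ρ, ‖e k ρ‖ ^ 2 : ℝ)) : ℂ)) =
        (∑ ν, conj (conj (r k ν) * lamb e r G ε ν) * e k ν) * ((star (e k) ⬝ᵥ β k) / (((∑ ρ, ‖e k ρ‖ ^ 2 : ℝ)) : ℂ)) := by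
      rw [Finset.sum_mul]
      exact Finset.sum_congr rfl fun ν _ => by ring
    rw [h3, hye, zero_mul, sub_zero]
  -- Step 4: Cauchy–Schwarz with the weights Δ^{∓1/2}
  set X : ι × Fin d → ℂ := fun i => (((Real.sqrt (lap e i.1))⁻¹ : ℝ) : ℂ) * (conj (r i.1 i.2) * lamb e r G ε i.2) with hX
  set Y : ι × Fin d → ℂ := fun i => ((Real.sqrt (lap e i.1) : ℝ) : ℂ) * (projK (e i.1) *ᵥ β i.1) i.2 with hY
  have hsq : ∀ k, Real.sqrt (lap e k) ≠ 0 := fun k => (Real.sqrt_pos.mpr (hlap k)).ne'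
  have hXY : ∑ i, conj (X i) * Y i = -((val e r G ε : ℝ) : ℂ) := by
    rw [← hS, Fintype.sum_prod_type]
    refine Finset.sum_congr rfl fun k _ => ?_
    rw [hproj k]
    refine Finset.sum_congr rfl fun ν _ => ?_
    simp only [hX, hY, map_mul, Complex.conj_ofReal, Complex.conj_conj]
    have h : ((((Real.sqrt (lap e k))⁻¹ : ℝ)) : ℂ) * ((Real.sqrt (lap e k) : ℝ) : ℂ) = 1 := by
      rw [← Complex.ofReal_mul, inv_mul_cancel₀ (hsq k), Complex.ofReal_one]
    calc ((((Real.sqrt (lap e k))⁻¹ : ℝ)) : ℂ) * (r k ν * conj (lamb e r G ε ν)) *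
          (((Real.sqrt (lap e k) : ℝ) : ℂ) * (projK (e k) *ᵥ β k) ν)
        = (((((Real.sqrt (lap e k))⁻¹ : ℝ)) : ℂ) * ((Real.sqrt (lap e k) : ℝ) : ℂ)) *
            (r k ν * conj (lamb e r G ε ν) * (projK (e k) *ᵥ β k) ν) := by ring
      _ = _ := by rw [h, one_mul]
  have hXX : ∑ i, ‖X i‖ ^ 2 = val e r G ε := by
    rw [Fintype.sum_prod_type]
    have h : ∀ k ν, ‖X (k, ν)‖ ^ 2 = ‖r k ν‖ ^ 2 / lap e k * ‖lamb e r G ε ν‖ ^ 2 := fun k ν => by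
      have hn : ‖X (k, ν)‖ = (Real.sqrt (lap e k))⁻¹ * (‖r k ν‖ * ‖lamb e r G ε ν‖) := by
        simp only [hX, norm_mul, Complex.norm_real, Real.norm_eq_abs, abs_inv, abs_of_nonneg (Real.sqrt_nonneg _),
          Complex.norm_conj]
      rw [hn, mul_pow, mul_pow, inv_pow, Real.sq_sqrt (hlap k).le, div_eq_mul_inv]
      ring
    simp only [h]
    rw [Finset.sum_comm]
    simp only [← Finset.sum_mul]
    rw [val]
    refine Finset.sum_congr rfl fun ν _ => ?_
    have hφ : phiL e r ν ≠ 0 := (hphi ν).ne'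
    rw [show (∑ k, ‖r k ν‖ ^ 2 / lap e k) = phiL e r ν from rfl, lamb, scl, norm_mul, mul_pow,
      norm_sqrtInv_sq hphi, ← mul_assoc, mul_inv_cancel₀ hφ, one_mul]
  have hYY : ∑ i, ‖Y i‖ ^ 2 = 1 / 2 * R := by
    rw [Fintype.sum_prod_type, hR, Finset.mul_sum]
    refine Finset.sum_congr rfl fun k _ => ?_
    have hl : lap e k ≠ 0 := (hlap k).ne'
    have h : ∀ ν, ‖Y (k, ν)‖ ^ 2 = lap e k * ‖(projK (e k) *ᵥ β k) ν‖ ^ 2 := fun ν => by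
      have hn : ‖Y (k, ν)‖ = Real.sqrt (lap e k) * ‖(projK (e k) *ᵥ β k) ν‖ := by
        simp only [hY, norm_mul, Complex.norm_real, Real.norm_eq_abs, abs_of_nonneg (Real.sqrt_nonneg _)]
      rw [hn, mul_pow, Real.sq_sqrt (hlap k).le]
    simp only [h, ← Finset.mul_sum]
    rw [normSq_projK_mulVec (e := e k) hl, show (∑ ρ, ‖e k ρ‖ ^ 2) = lap e k from rfl]
    calc lap e k * (1 / 2 * (lap e k)⁻¹ * ∑ μ, ∑ ν, ‖e k μ * β k ν - e k ν * β k μ‖ ^ 2)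
        = 1 / 2 * (lap e k * (lap e k)⁻¹) * ∑ μ, ∑ ν, ‖e k μ * β k ν - e k ν * β k μ‖ ^ 2 := by ring
      _ = 1 / 2 * ∑ μ, ∑ ν, ‖e k μ * β k ν - e k ν * β k μ‖ ^ 2 := by rw [mul_inv_cancel₀ hl, mul_one]
  have hV : 0 ≤ val e r G ε := Finset.sum_nonneg fun ν _ => sq_nonneg _
  have hR0 : 0 ≤ R :=
    Finset.sum_nonneg fun k _ => Finset.sum_nonneg fun μ _ => Finset.sum_nonneg fun ν _ => sq_nonneg _
  have hCS := norm_sum_conj_mul_sq_le X Y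
  rw [hXY, hXX, hYY, norm_neg, Complex.norm_real, Real.norm_eq_abs, abs_of_nonneg hV] at hCS
  -- Step 5: V² ≤ V·R/2 ⇒ 2V ≤ R
  rcases hV.eq_or_lt with h0 | hpos
  · have : val e r G ε = 0 := h0.symm
    linarith
  · have : val e r G ε ≤ 1 / 2 * R := by
      have h := hCS
      rw [pow_two] at h
      exact le_of_mul_le_mul_left h hpos
    linarith

end Lower

end

end Literature.MathematicalPhysics.QuantumFieldTheory.BalabanImbrieJaffe1984to88.BIJ85Eq7113LagrangeFibre
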